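import Summits.HubbardSuperconductivity.HubbardSuperconductivity.Theorems.CwChiralConstruction.Negative.FreeGasDensity
import Summits.HubbardSuperconductivity.HubbardSuperconductivity.Theorems.CwChiralConstruction.Negative.CooperLegendreCeiling

/-!
# Crux `CwChiralConstruction` (item `stmt-HubbardSuperconductivity-1740`, route `ChiralWindow`):
# density pinning, and the refuted strengthenings of the VERBATIM crux

Negative-side support lemmas from the standing disprover (cdisprove, cycle 2), part 3c.

* `density_ge_of_mu_ge` / `density_le_of_mu_le` — for `L ≥ 400`, `|U| ≤ 10⁻³`: `μ ≥ -1/20 ⇒` density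
  `≥ 0.72`, `μ ≤ -37/10 ⇒` density `≤ 0.5` (parts 3a–3b);
* `density_window_pins_mu` — **DENSITY PINNING**: if `|U| ≤ 10⁻³` and the tracial GC ground-state density
  of `hubbardTorusWith 2 (L+1) 1 U μ` tends to `n ∈ [0.52, 0.70]`, then `μ ∈ [-37/10, -1/20] ⊂ (-4,0)`;
  `cwChiralConstruction_densityClause_pins_mu` — the same for the crux's clause (`n = 1 - δ`,
  `δ ∈ [3/10, 12/25]`);
* consequences for the crux AS TYPED (μ unrestricted, density clause verbatim), via part 2's ceiling:
  `cwChiralConstruction_false_uniformFloor` — the floor `exp(-C/U²)` cannot be replaced by a constant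
  `c₀ > 0`; `cwChiralConstruction_false_powerFloor` — nor by `c·U^p` with `p < 1/2`;
  `cwChiralConstruction_false_withZeroCoupling` — nor can `U ∈ (0,U₀)` be relaxed to `U ∈ [0,U₀)`
  (at `U = 0` Lean reads `exp(-C/0²) = 1`, while the pinned free gas has order parameter `0`);
* `cwChiralConstruction_pinned` — a NECESSARY-CONDITION form of the crux for later refuters: any witness
  may be assumed to have `U₀ ≤ 10⁻³` and `μ ∈ [-37/10, -1/20]` (where part 2's ceiling applies).

Sources: as in parts 1–3b [KomaTasaki1994].
-/

noncomputable section

namespace Summit.HubbardSuperconductivity.CwChiralConstruction.Negative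

open Matrix Finset Filter Literature.MathematicalPhysics.QuantumLattice Literature.Probability.LatticeModels
open Summit.HubbardSuperconductivity.HubbardSuperconductivity.Theorems
open scoped Matrix.Norms.L2Operator ComplexOrder Topology

/-! ### G. Large tori: density thresholds and the pinning of `μ` -/

section Pinning

variable {L : ℕ} [NeZero L]

/-- **Deep in the band the density is large.** For `L ≥ 400`, `|U| ≤ 10⁻³` and `μ ≥ -1/20`:
`Re ω_{U,μ}(N) ≥ (18/25)·L²` (density `≥ 0.72`). [folklore] -/
theorem density_ge_of_mu_ge (hL : 400 ≤ L) {U μ : ℝ} (hU : |U| ≤ 1 / 1000) (hμ : -(1 : ℝ) / 20 ≤ μ) :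
    (18 : ℝ) / 25 * (L : ℝ) ^ 2 ≤ ((hubbardTorusWith 2 L 1 U μ).groundStateFunctional totalNumber).re := by
  have hL3 : 3 ≤ L := by omega
  have hℓ : (400 : ℝ) ≤ L := by exact_mod_cast hL
  have key := density_mul_ge hL3 U μ (η := 1 / 20) (by norm_num)
  -- the diamond count at threshold `-1/10 ≤ μ - 1/20`
  set m : ℕ := 11 * L / 25 with hm
  have hm2 : 2 * m < L := by omega
  have hm_le : (m : ℝ) ≤ 11 * L / 25 := by
    have : (m : ℝ) * 25 ≤ 11 * L := by
      have h : m * 25 ≤ 11 * L := Nat.div_mul_le_self (11 * L) 25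
      exact_mod_cast h
    linarith
  have hm_ge : (11 * L - 24 : ℝ) / 25 ≤ m := by
    have : 11 * L ≤ m * 25 + 24 := by omega
    have h' : (11 * L : ℝ) ≤ (m : ℝ) * 25 + 24 := by exact_mod_cast this
    rw [div_le_iff₀ (by norm_num : (0:ℝ) < 25)]
    linarith
  have hπ := Real.pi_gt_three
  have hLpos : (0 : ℝ) < L := by linarith
  have hangle : 2 * Real.pi * m / L ≤ Real.pi - 1 / 3 := by
    rw [div_le_iff₀ hLpos]
    nlinarith [mul_le_mul_of_nonneg_left hm_le (by positivity : (0:ℝ) ≤ 2 * Real.pi)]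
  have hcount := card_filter_torusBand_le_ge (L := L) m hm2 hangle
  have hmono : (Finset.univ.filter fun k : TorusSite 2 L => torusBand L k ≤ -(1 : ℝ) / 10).card ≤
      (Finset.univ.filter fun k : TorusSite 2 L => torusBand L k ≤ μ - 1 / 20).card := by
    refine Finset.card_le_card (Finset.monotone_filter_right _ fun k _ hk => ?_)
    exact hk.trans (by linarith)
  have hN : ((m : ℝ) + 1) ^ 2 + (m : ℝ) ^ 2 ≤
      ((Finset.univ.filter fun k : TorusSite 2 L => torusBand L k ≤ μ - 1 / 20).card : ℝ) := by
    exact_mod_cast hcount.trans hmono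
  -- arithmetic: `2((m+1)² + m²) - L²/25 ≥ (18/25)L²` for `L ≥ 400`
  set a : ℝ := (m : ℝ)
  have hb0 : (0 : ℝ) ≤ (11 * L - 24) / 25 := by
    rw [le_div_iff₀ (by norm_num : (0:ℝ) < 25)]; linarith
  have ha2 : ((11 * L - 24 : ℝ) / 25) ^ 2 ≤ a ^ 2 := pow_le_pow_left₀ hb0 hm_ge 2
  nlinarith [hN, key, ha2, hm_ge, hU, sq_nonneg (L : ℝ), mul_le_mul_of_nonneg_left hℓ hLpos.le]

/-- **Near the band bottom the density is small.** For `L ≥ 400`, `|U| ≤ 10⁻³` and `μ ≤ -37/10`: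
`Re ω_{U,μ}(N) ≤ L²/2`. [folklore] -/
theorem density_le_of_mu_le (hL : 400 ≤ L) {U μ : ℝ} (hU : |U| ≤ 1 / 1000) (hμ : μ ≤ -(37 : ℝ) / 10) :
    ((hubbardTorusWith 2 L 1 U μ).groundStateFunctional totalNumber).re ≤ (L : ℝ) ^ 2 / 2 := by
  have hL3 : 3 ≤ L := by omega
  have hℓ : (400 : ℝ) ≤ L := by exact_mod_cast hL
  have key := density_mul_le hL3 U μ (η := 1 / 20) (by norm_num)
  have hmono : (Finset.univ.filter fun k : TorusSite 2 L => torusBand L k < μ + 2 * (1 / 20)).card ≤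
      (Finset.univ.filter fun k : TorusSite 2 L => torusBand L k < -(18 : ℝ) / 5).card := by
    refine Finset.card_le_card (Finset.monotone_filter_right _ fun k _ hk => ?_)
    exact lt_of_lt_of_le hk (by linarith)
  have hcount := card_filter_torusBand_lt_le (L := L)
  have hN : ((Finset.univ.filter fun k : TorusSite 2 L => torusBand L k < μ + 2 * (1 / 20)).card : ℝ) ≤
      (2 * (13 * L / (40 * Real.pi) + 1)) ^ 2 := by
    exact (show ((Finset.univ.filter fun k : TorusSite 2 L => torusBand L k < μ + 2 * (1 / 20)).card : ℝ) ≤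
      ((Finset.univ.filter fun k : TorusSite 2 L => torusBand L k < -(18 : ℝ) / 5).card : ℝ) by
        exact_mod_cast hmono).trans hcount
  have hπ := Real.pi_gt_three
  have hB : 13 * L / (40 * Real.pi) ≤ 13 * L / 120 := by
    refine div_le_div_of_nonneg_left (by positivity) (by norm_num) (by nlinarith)
  have hB2 : (2 * (13 * L / (40 * Real.pi) + 1)) ^ 2 ≤ (2 * (13 * L / 120 + 1)) ^ 2 := by
    refine pow_le_pow_left₀ (by positivity) (by linarith) 2
  nlinarith [hN, key, hB2, hU, sq_nonneg (L : ℝ), hℓ]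

/-- **Density pinning at weak coupling.** If `|U| ≤ 10⁻³` and the tracial grand-canonical ground-state
density of `hubbardTorusWith 2 (L+1) 1 U μ` tends to some `n ∈ [0.52, 0.70]`, then
`μ ∈ [-37/10, -1/20]` — a compact of the hole-doped free band `(-4, 0)`. [folklore] -/
theorem density_window_pins_mu {U μ n : ℝ} (hU : |U| ≤ 1 / 1000) (hn : n ∈ Set.Icc ((13 : ℝ) / 25) (7 / 10))
    (hlim : Tendsto (fun L : ℕ => ((hubbardTorusWith 2 (L + 1) 1 U μ).groundStateFunctional
      totalNumber).re / ((L + 1 : ℕ) : ℝ) ^ 2) atTop (𝓝 n)) :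
    μ ∈ Set.Icc (-(37 : ℝ) / 10) (-(1 : ℝ) / 20) := by
  constructor
  · rcases lt_or_ge μ (-(37 : ℝ) / 10) with h | h
    · exfalso
      have hev : ∀ᶠ L : ℕ in atTop, ((hubbardTorusWith 2 (L + 1) 1 U μ).groundStateFunctional
          totalNumber).re / ((L + 1 : ℕ) : ℝ) ^ 2 ≤ 1 / 2 := by
        filter_upwards [eventually_ge_atTop 399] with L hL
        have hd := density_le_of_mu_le (L := L + 1) (by omega) hU h.le
        have hpos : (0 : ℝ) < (((L + 1 : ℕ) : ℝ)) ^ 2 := by positivity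
        rw [div_le_iff₀ hpos]
        linarith
      have := le_of_tendsto hlim hev
      linarith [hn.1]
    · exact h
  · rcases le_or_gt μ (-(1 : ℝ) / 20) with h | h
    · exact h
    · exfalso
      have hev : ∀ᶠ L : ℕ in atTop, (18 : ℝ) / 25 ≤ ((hubbardTorusWith 2 (L + 1) 1 U μ).groundStateFunctional
          totalNumber).re / ((L + 1 : ℕ) : ℝ) ^ 2 := by
        filter_upwards [eventually_ge_atTop 399] with L hL
        have hd := density_ge_of_mu_ge (L := L + 1) (by omega) hU h.le
        have hpos : (0 : ℝ) < (((L + 1 : ℕ) : ℝ)) ^ 2 := by positivity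
        rw [le_div_iff₀ hpos]
        linarith
      have := ge_of_tendsto hlim hev
      linarith [hn.2]

/-- **The density clause of the crux pins the chemical potential.** For `|U| ≤ 10⁻³` and a doping
`δ ∈ [3/10, 12/25]`, the crux's density clause forces `μ ∈ [-37/10, -1/20] ⊂ (-4, 0)`. [folklore] -/
theorem cwChiralConstruction_densityClause_pins_mu {U μ δ : ℝ} (hU : |U| ≤ 1 / 1000)
    (hδ : δ ∈ Set.Icc (3 / 10 : ℝ) (12 / 25))
    (hdens : Tendsto (fun L : ℕ => ((hubbardTorusWith 2 (L + 1) 1 U μ).groundStateFunctional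
      totalNumber).re / ((L + 1 : ℕ) : ℝ) ^ 2) atTop (𝓝 (1 - δ))) :
    μ ∈ Set.Icc (-(37 : ℝ) / 10) (-(1 : ℝ) / 20) :=
  density_window_pins_mu hU ⟨by linarith [hδ.2], by linarith [hδ.1]⟩ hdens

end Pinning

/-! ### Refuted strengthenings of the verbatim crux -/

section Verbatim

/-- **No constant floor (verbatim crux).** `CwChiralConstruction` with `exp(-C/U²)` replaced by a constant
`c₀ > 0` — `μ : ℝ` unrestricted, density clause verbatim — is FALSE. [cite: KomaTasaki1994, §1] -/
theorem cwChiralConstruction_false_uniformFloor :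
    ¬ (∃ U₀ : ℝ, 0 < U₀ ∧ ∃ c₀ : ℝ, 0 < c₀ ∧ ∀ U ∈ Set.Ioo (0:ℝ) U₀,
        ∃ δ ∈ Set.Icc (3/10 : ℝ) (12/25), ∃ μ : ℝ,
          Tendsto (fun L : ℕ => ((hubbardTorusWith 2 (L + 1) 1 U μ).groundStateFunctional
            totalNumber).re / ((L + 1 : ℕ) : ℝ) ^ 2) atTop (𝓝 (1 - δ)) ∧
          c₀ ≤ dWaveOrderParameter U μ) := by
  rintro ⟨U₀, hU₀, c₀, hc₀, H⟩
  apply cwChiralConstruction_false_uniformFloorOn (μ₁ := -(37 : ℝ) / 10) (μ₂ := -(1 : ℝ) / 20)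
    (by norm_num) (by norm_num) (by norm_num)
  refine ⟨min U₀ (1 / 1000), lt_min hU₀ (by norm_num), c₀, hc₀, fun U hU => ?_⟩
  obtain ⟨δ, hδ, μ, hdens, hfloor⟩ := H U ⟨hU.1, lt_of_lt_of_le hU.2 (min_le_left _ _)⟩
  have hUabs : |U| ≤ 1 / 1000 := by
    rw [abs_of_pos hU.1]; exact (hU.2.le.trans (min_le_right _ _))
  exact ⟨δ, hδ, μ, cwChiralConstruction_densityClause_pins_mu hUabs hδ hdens, hdens, hfloor⟩

/-- **No power-law floor `c·U^p`, `p < 1/2` (verbatim crux).** [cite: KomaTasaki1994, §1] -/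
theorem cwChiralConstruction_false_powerFloor {p : ℝ} (hp : p < 1 / 2) :
    ¬ (∃ U₀ : ℝ, 0 < U₀ ∧ ∃ c : ℝ, 0 < c ∧ ∀ U ∈ Set.Ioo (0:ℝ) U₀,
        ∃ δ ∈ Set.Icc (3/10 : ℝ) (12/25), ∃ μ : ℝ,
          Tendsto (fun L : ℕ => ((hubbardTorusWith 2 (L + 1) 1 U μ).groundStateFunctional
            totalNumber).re / ((L + 1 : ℕ) : ℝ) ^ 2) atTop (𝓝 (1 - δ)) ∧
          c * U ^ p ≤ dWaveOrderParameter U μ) := by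
  rintro ⟨U₀, hU₀, c, hc, H⟩
  apply cwChiralConstruction_false_powerFloorOn (μ₁ := -(37 : ℝ) / 10) (μ₂ := -(1 : ℝ) / 20)
    (by norm_num) (by norm_num) (by norm_num) hp
  refine ⟨min U₀ (1 / 1000), lt_min hU₀ (by norm_num), c, hc, fun U hU => ?_⟩
  obtain ⟨δ, hδ, μ, hdens, hfloor⟩ := H U ⟨hU.1, lt_of_lt_of_le hU.2 (min_le_left _ _)⟩
  have hUabs : |U| ≤ 1 / 1000 := by
    rw [abs_of_pos hU.1]; exact (hU.2.le.trans (min_le_right _ _))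
  exact ⟨δ, hδ, μ, cwChiralConstruction_densityClause_pins_mu hUabs hδ hdens, hdens, hfloor⟩

/-- **`0 < U` is load-bearing (verbatim crux).** With `U ∈ [0, U₀)` in place of `U ∈ (0, U₀)` the crux is
FALSE: at `U = 0` the density clause pins `μ` into `(-4,0)`, where the free gas has order parameter `0`
(`dWaveOrderParameter_free_eq_zero`), while Lean reads the floor `exp(-C/0²)` as `exp 0 = 1`.
[cite: KomaTasaki1994, §1] -/
theorem cwChiralConstruction_false_withZeroCoupling :
    ¬ (∃ U₀ : ℝ, 0 < U₀ ∧ ∃ C : ℝ, 0 < C ∧ ∀ U ∈ Set.Ico (0:ℝ) U₀,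
        ∃ δ ∈ Set.Icc (3/10 : ℝ) (12/25), ∃ μ : ℝ,
          Tendsto (fun L : ℕ => ((hubbardTorusWith 2 (L + 1) 1 U μ).groundStateFunctional
            totalNumber).re / ((L + 1 : ℕ) : ℝ) ^ 2) atTop (𝓝 (1 - δ)) ∧
          Real.exp (-C / U ^ 2) ≤ dWaveOrderParameter U μ) := by
  rintro ⟨U₀, hU₀, C, _, H⟩
  obtain ⟨δ, hδ, μ, hdens, hfloor⟩ := H 0 ⟨le_rfl, hU₀⟩
  have hμ := cwChiralConstruction_densityClause_pins_mu (U := 0) (by norm_num) hδ hdens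
  have h0 := dWaveOrderParameter_free_eq_zero (μ := μ) (by linarith [hμ.1]) (by linarith [hμ.2])
  rw [h0] at hfloor
  have : Real.exp (-C / (0 : ℝ) ^ 2) = 1 := by simp
  rw [this] at hfloor
  linarith

end Verbatim


/-! ### The crux implies its pinned form -/

section Pinned

/-- **Pinned form of the crux (necessary condition).** If the crux `CwChiralConstruction` holds (its body
is the hypothesis, verbatim; the route file is deliberately not imported) then it holds with
`U₀ ≤ 10⁻³` and a chemical potential confined to `[-37/10, -1/20]`: later refuters need only beat the
order parameter for `μ` in this compact of the hole-doped free band. [folklore] -/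
theorem cwChiralConstruction_pinned
    (h : ∃ U₀ : ℝ, 0 < U₀ ∧ ∃ C : ℝ, 0 < C ∧ ∀ U ∈ Set.Ioo (0:ℝ) U₀,
      ∃ δ ∈ Set.Icc (3/10 : ℝ) (12/25), ∃ μ : ℝ,
        Tendsto (fun L : ℕ => ((hubbardTorusWith 2 (L + 1) 1 U μ).groundStateFunctional
          totalNumber).re / ((L + 1 : ℕ) : ℝ) ^ 2) atTop (𝓝 (1 - δ)) ∧
        Real.exp (-C / U ^ 2) ≤ dWaveOrderParameter U μ) :
    ∃ U₀ : ℝ, 0 < U₀ ∧ U₀ ≤ 1 / 1000 ∧ ∃ C : ℝ, 0 < C ∧ ∀ U ∈ Set.Ioo (0:ℝ) U₀,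
      ∃ δ ∈ Set.Icc (3/10 : ℝ) (12/25), ∃ μ ∈ Set.Icc (-(37 : ℝ) / 10) (-(1 : ℝ) / 20),
        Tendsto (fun L : ℕ => ((hubbardTorusWith 2 (L + 1) 1 U μ).groundStateFunctional
          totalNumber).re / ((L + 1 : ℕ) : ℝ) ^ 2) atTop (𝓝 (1 - δ)) ∧
        Real.exp (-C / U ^ 2) ≤ dWaveOrderParameter U μ := by
  obtain ⟨U₀, hU₀, C, hC, H⟩ := h
  refine ⟨min U₀ (1 / 1000), lt_min hU₀ (by norm_num), min_le_right _ _, C, hC, fun U hU => ?_⟩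
  obtain ⟨δ, hδ, μ, hdens, hfloor⟩ := H U ⟨hU.1, lt_of_lt_of_le hU.2 (min_le_left _ _)⟩
  have hUabs : |U| ≤ 1 / 1000 := by
    rw [abs_of_pos hU.1]; exact (hU.2.le.trans (min_le_right _ _))
  exact ⟨δ, hδ, μ, cwChiralConstruction_densityClause_pins_mu hUabs hδ hdens, hdens, hfloor⟩

end Pinned

end Summit.HubbardSuperconductivity.CwChiralConstruction.Negative

end
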